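import Summits.Schanuel.Schanuel.Theorems.ZilberEacSuperellipticFibreCurves
import HarnessLib

/-!
# Arbitrary base branches, XXXIX: FIBRE CURVES over `x₁^k = P(x₀)` for EVERY `k` with `deg P ≠ k`
# — zero values by the pole route, finite values by one direction or by the `τ`-coefficient

HONEST FRAMING.  Cell `pub-schanuel` (Zilber's Exponential-Algebraic Closedness, case ladder;
host summit Schanuel), seat 2, gen 29.  File XXXVIII settled fibre curves `F(x₀, y₀) = 0` over the
cyclic covers with `k ≥ 3` (non-real sheets).  Here the principal sheet does the work, so `k = 2`
(hyperelliptic bases) and `k = 1` (polynomial graphs, for the record) are included: along the sheet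
`x₀ = s^{-k}`, `x₁ = U₀(s)^{1/k}s^{-M}` (`Φ(0) = 1`, and — **`superelliptic_sheet_facts_taylor`** —
`(Φ(s) − 1)/s^k → p_{M−1}/k`) a Puiseux branch `y₀ = ψ(t) → θ` of `F` at `x₀ = ∞` is combined on
`s = σ^{e}`, `t = σ^k`.  THREE MECHANISMS: `θ = 0` ⟹ a zero fibre value, the pole route with no
direction condition (files XXXV/XXXVI, `deg P > k`, or XXXIV/XXXII otherwise); `θ ≠ 0` off the residue
class `k ∣ 2M ∧ 2M/k ≡ 2 (mod 4)` ⟹ one good direction (files XIX/XX); `θ ≠ 0` in the residue class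
⟹ the `τ`-coefficient (file XXIX) with the combined ramification, i.e. density OFF the circle
`M·log|θ| + Re p_{M−1} = 0`.  Hence **`unprojectedDense_superelliptic_fibreCurve_principal`**:
`1 ≤ k`, `deg P = M ≠ k`, `P` monic, `F` irreducible of positive `y₀`-degree with `F(x₀, 0) ≢ 0`,
top row `T ≠ 0` with a root `θ`, and — only when `θ ≠ 0` lies in the residue class — `θ` off the
circle ⟹ every irreducible `S ⊇` cylinder over `C ×_{x₀} F` is dense; in particular
(**`unprojectedDense_hyperelliptic_fibreCurve`**) over every hyperelliptic curve `x₁² = P(x₀)` of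
degree `≥ 3`.  ON the circle (`k = 2`, `deg P ≡ 2 (mod 4)`) the question stays OPEN.  Decided
instances of an OPEN question (Mantova–Masser, PLMS 2024 §1 p. 5); EC(3,2) OPEN; NOT Schanuel's
conjecture (neither used nor implied); EAC ⇏ SC.
-/

noncomputable section

open Filter Topology Set Complex
open Literature.NumberTheory.Transcendental Literature.ModelTheory.Zilber
open Literature.ModelTheory.ExponentialFields

set_option linter.dupNamespace false

namespace Summit.Schanuel.Schanuel.Theorems

section Superelliptic

variable (P : Polynomial ℂ)

/-! ## Part A. The principal sheet with its second Taylor datum -/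

/-- **The principal sheet to second order**: for `P` monic of degree `M ≥ 1` and `k ≥ 1` there is
`Φ` analytic at `0` with `Φ(0) = 1`, `(Φ(s) − 1)/s^k → p_{M−1}/k`, `‖Φ(s) − 1‖ = O(‖s‖^k)`, and
`(Φ(s)s^{-M})^k = P(s^{-k})` for small `s ≠ 0`. [folklore] -/
theorem superelliptic_sheet_facts_taylor {k : ℕ} (hk : 1 ≤ k) (hP : P.Monic) (hM : 1 ≤ P.natDegree) :
    ∃ Φ : ℂ → ℂ, AnalyticAt ℂ Φ 0 ∧ Φ 0 = 1 ∧
      Tendsto (fun s => (Φ s - 1) / s ^ k) (𝓝[≠] (0 : ℂ)) (𝓝 (P.coeff (P.natDegree - 1) / k)) ∧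
      (∃ K : ℝ, ∀ᶠ s in 𝓝 (0 : ℂ), ‖Φ s - Φ 0‖ ≤ K * ‖s‖ ^ k) ∧
      ∀ᶠ s in 𝓝[≠] (0 : ℂ), (Φ s * (s ^ P.natDegree)⁻¹) ^ k - P.eval (s ^ k)⁻¹ = 0 := by
  set M := P.natDegree with hMdef
  obtain ⟨q, hqan, hq0, hqk⟩ := kthRoot_branch_facts hk
  obtain ⟨U₀, hUan, hU0, hUeval⟩ :=
    exists_polarForm_eval P (U := fun _ : ℂ => (1 : ℂ)) analyticAt_const hk
  rw [one_pow, mul_one, hP.leadingCoeff] at hU0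
  have hvan : AnalyticAt ℂ (fun s => U₀ s - 1) 0 := hUan.sub analyticAt_const
  have hv0 : U₀ 0 - 1 = 0 := by rw [hU0, sub_self]
  have hqk' : ∀ᶠ s in 𝓝 (0 : ℂ), q (U₀ s - 1) ^ k = 1 + (U₀ s - 1) := by
    have h := hvan.continuousAt.tendsto
    rw [hv0] at h
    exact h.eventually hqk
  have hvt0 : Tendsto (fun s => U₀ s - 1) (𝓝[≠] (0 : ℂ)) (𝓝 0) := by
    have h := hvan.continuousAt.tendsto
    rw [hv0] at h
    exact h.mono_left nhdsWithin_le_nhds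
  have hvt : Tendsto (fun s => (U₀ s - 1) / s ^ k) (𝓝[≠] (0 : ℂ)) (𝓝 (P.coeff (M - 1))) := by
    refine (tendsto_monic_polar_sub_one_div_pow hP hMdef.symm hM hk).congr' ?_
    filter_upwards [self_mem_nhdsWithin] with s (hs : s ≠ 0)
    have hU := hUeval s hs
    simp only [one_mul, inv_pow] at hU
    rw [inv_pow, hU, ← hMdef, mul_assoc, inv_mul_cancel₀ (pow_ne_zero _ hs), mul_one]
  have hΦt : Tendsto (fun s => (q (U₀ s - 1) - 1) / s ^ k) (𝓝[≠] (0 : ℂ))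
      (𝓝 (P.coeff (M - 1) / k)) :=
    tendsto_kthRoot_comp_sub_one_div_pow hqan hq0 hk hqk hvt0 hvt
  refine ⟨fun s => q (U₀ s - 1), hqan.comp_of_eq hvan hv0, by simp only [hU0, sub_self, hq0], hΦt,
    ?_, ?_⟩
  · -- `O(‖s‖^k)` from the limit
    have h1 : ∀ᶠ s in 𝓝[≠] (0 : ℂ), ‖(q (U₀ s - 1) - 1) / s ^ k‖ < ‖P.coeff (M - 1) / k‖ + 1 := by
      have h := (continuous_norm.tendsto _).comp hΦt
      exact (tendsto_order.1 h).2 _ (by simp)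
    refine ⟨‖P.coeff (M - 1) / (k : ℂ)‖ + 1, ?_⟩
    have h2 : ∀ᶠ s in 𝓝[≠] (0 : ℂ), ‖q (U₀ s - 1) - 1‖ ≤ (‖P.coeff (M - 1) / (k : ℂ)‖ + 1) * ‖s‖ ^ k := by
      filter_upwards [h1, self_mem_nhdsWithin] with s hs (hs0 : s ≠ 0)
      have hsk : 0 < ‖s‖ ^ k := pow_pos (norm_pos_iff.2 hs0) _
      rw [norm_div, norm_pow, div_lt_iff₀ hsk] at hs
      exact hs.le
    refine (eventually_nhdsWithin_iff.1 h2).mono fun s hs => ?_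
    simp only [hU0, sub_self, hq0]
    by_cases hs0 : s = 0
    · rw [hs0, hU0, sub_self, hq0, sub_self, norm_zero]
      positivity
    · exact hs hs0
  · filter_upwards [self_mem_nhdsWithin, nhdsWithin_le_nhds hqk'] with s (hs : s ≠ 0) hqs
    have hU := hUeval s hs
    simp only [one_mul, inv_pow] at hU
    rw [mul_pow, hqs, hU, inv_pow, ← pow_mul, Nat.mul_comm M k,
      show (1 : ℂ) + (U₀ s - 1) = U₀ s by ring, sub_self]

/-! ## Part B. Finite nonzero fibre values on the ramified principal sheet -/

/-- **Finite nonzero fibre value on the principal sheet, ramified, off the residue class or off the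
circle.**  `1 ≤ k`, `P` monic of degree `M ≥ 1`; a cylinder germ
`((σ^{Nk})^{-1}, Φ(σ^N)σ^{-NM}, ψ(σ), e^{x₁})` in `S` with `Φ` the principal sheet, `N ≥ 1`,
`ψ(0) = θ ≠ 0`; and either `¬(k ∣ 2M ∧ 2M/k ≡ 2 mod 4)`, or `k < M` and
`M·log|θ| + Re p_{M−1} ≠ 0`.  Then `S` is dense. [cite: MantovaMasser2023, §1 Further remarks, p. 5
(the question, open in general)] (new) -/
theorem unprojectedDense_superelliptic_principal_finite_ram {S : Set (Fin 2 ⊕ Fin 2 → ℂ)}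
    (hS : IsIrreducibleClosed ℂ S) (hdim : zariskiDim ℂ S ≤ (2 : ℕ)) {k : ℕ} (hk : 1 ≤ k)
    (hM : 1 ≤ P.natDegree) {Φ : ℂ → ℂ} (hΦan : AnalyticAt ℂ Φ 0) (hΦ0 : Φ 0 = 1)
    (hΦt : Tendsto (fun s => (Φ s - 1) / s ^ k) (𝓝[≠] (0 : ℂ))
      (𝓝 (P.coeff (P.natDegree - 1) / k)))
    {N : ℕ} (hN : 1 ≤ N) {ψ : ℂ → ℂ} (hψ : AnalyticAt ℂ ψ 0) {θ : ℂ} (hθ0 : θ ≠ 0)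
    (hψ0 : ψ 0 = θ)
    (halt : ¬ (k ∣ 2 * P.natDegree ∧ (2 * P.natDegree / k) % 4 = 2) ∨
      (k < P.natDegree ∧
        (P.natDegree : ℝ) * Real.log ‖θ‖ + (P.coeff (P.natDegree - 1)).re ≠ 0))
    (hgerm : ∀ᶠ σ in 𝓝[≠] (0 : ℂ),
      (Sum.elim ![(σ ^ (N * k))⁻¹, Φ (σ ^ N) * (σ ^ (N * P.natDegree))⁻¹]
        ![ψ σ, Complex.exp (Φ (σ ^ N) * (σ ^ (N * P.natDegree))⁻¹)] : Fin 2 ⊕ Fin 2 → ℂ) ∈ S) :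
    UnprojectedDense S := by
  set M := P.natDegree with hMdef
  have hk0 : k ≠ 0 := by omega
  have hN0 : N ≠ 0 := by omega
  have hNk : 1 ≤ N * k := Nat.mul_pos hN hk
  have hNM : 1 ≤ N * M := Nat.mul_pos hN hM
  have hΦN : AnalyticAt ℂ (fun σ : ℂ => Φ (σ ^ N)) 0 :=
    hΦan.comp_of_eq (analyticAt_id.pow N) (by simp [zero_pow hN0])
  have hΦN0 : Φ ((0 : ℂ) ^ N) = 1 := by simp [zero_pow hN0, hΦ0]
  by_cases hres : k ∣ 2 * M ∧ (2 * M / k) % 4 = 2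
  · -- the residue class: the `τ`-coefficient for `(Nk, NM)`, off the circle
    obtain ⟨hkM, hθP⟩ : k < M ∧ (M : ℝ) * Real.log ‖θ‖ + (P.coeff (M - 1)).re ≠ 0 :=
      halt.resolve_left (not_not.2 hres)
    have hkC : (k : ℂ) ≠ 0 := Nat.cast_ne_zero.2 hk0
    set PΦ : Polynomial ℂ := Polynomial.C 1 + Polynomial.C (P.coeff (M - 1) / k) *
      Polynomial.X ^ (N * k) with hPΦ
    have hPΦdeg : PΦ.natDegree ≤ N * k := by
      refine Polynomial.natDegree_add_le_of_degree_le ?_ (Polynomial.natDegree_C_mul_X_pow_le _ _)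
      rw [Polynomial.natDegree_C]
      exact Nat.zero_le _
    have hPΦk : PΦ.coeff (N * k) = P.coeff (M - 1) / k := by
      rw [hPΦ, Polynomial.coeff_add, Polynomial.coeff_C, if_neg (by positivity),
        Polynomial.coeff_C_mul_X_pow, if_pos rfl, zero_add]
    have hΦT : Tendsto (fun σ : ℂ => (Φ (σ ^ N) - PΦ.eval σ) / σ ^ (N * k)) (𝓝[≠] (0 : ℂ))
        (𝓝 0) := by
      have h1 := hΦt.comp (tendsto_pow_punctured_nhds_zero hN)
      have h2 := h1.sub_const (P.coeff (M - 1) / k)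
      rw [sub_self] at h2
      refine h2.congr' ?_
      filter_upwards [self_mem_nhdsWithin] with σ (hσ : σ ≠ 0)
      have hsk : (σ ^ N) ^ k ≠ 0 := pow_ne_zero _ (pow_ne_zero _ hσ)
      simp only [Function.comp_apply, hPΦ, Polynomial.eval_add, Polynomial.eval_C,
        Polynomial.eval_mul, Polynomial.eval_pow, Polynomial.eval_X, pow_mul]
      field_simp
      ring
    have hres' : N * k ∣ 2 * (N * M) ∧ (2 * (N * M) / (N * k)) % 4 = 2 := by
      obtain ⟨hdvd, hmod⟩ := hres
      refine ⟨?_, ?_⟩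
      · rw [Nat.mul_left_comm]
        exact Nat.mul_dvd_mul_left N hdvd
      · rw [Nat.mul_left_comm, Nat.mul_div_mul_left _ _ (by omega : 0 < N)]
        exact hmod
    obtain ⟨z, hz, him, hre⟩ := exists_real_direction_of_residue (k := N * k) (M := N * M) hNk hres'
    refine unprojectedDense_branch_growth_of_tau_coeff hS hdim hNk
      (Nat.mul_lt_mul_left (by omega) |>.2 hkM) hψ hθ0 hψ0 hΦN hPΦdeg hΦT ⟨z, hz, ?_⟩ hgerm
    have hquant : z ^ (N * M - N * k) * (PΦ.coeff (N * k) +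
        ((N * M : ℕ) : ℂ) / ((N * k : ℕ) : ℂ) * Complex.log θ * Φ ((0 : ℂ) ^ N)) =
        z ^ (N * M - N * k) * ((P.coeff (M - 1) + ((M : ℝ) : ℂ) * Complex.log θ) / k) := by
      rw [hPΦk, hΦN0, Complex.ofReal_natCast]
      have hNC : (N : ℂ) ≠ 0 := Nat.cast_ne_zero.2 hN0
      push_cast
      field_simp
    rw [hquant, Complex.mul_re, him, zero_mul, sub_zero, Complex.div_natCast_re, Complex.add_re,
      Complex.re_ofReal_mul, Complex.log_re]
    refine mul_ne_zero hre (div_ne_zero ?_ (Nat.cast_ne_zero.2 hk0))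
    rw [add_comm]
    exact hθP
  · -- one good direction for `(Nk, NM)`: from one for `(k, M)` (same residue data)
    obtain ⟨z, hz, hzre⟩ := exists_direction_powerCurve hk hres (M := M)
    obtain ⟨zt, hzt⟩ := IsAlgClosed.exists_pow_nat_eq z (by omega : 0 < N)
    refine unprojectedDense_branch_growth_of_exists_direction hS hdim hNk hNM hψ hθ0 hψ0 hΦN
      ⟨zt, by rw [pow_mul, hzt, hz], ?_⟩ hgerm
    rw [hΦN0, one_mul, pow_mul, hzt]
    exact hzre

/-! ## Part C. Fibre curves over `x₁^k = P(x₀)`, `deg P ≠ k`, principal sheet -/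

/-- **Fibre curves over `x₁^k = P(x₀)` on the principal sheet.**  `S` irreducible closed of
dimension `≤ 2` containing every `(x₀, x₁, y₀, e^{x₁})` with `x₁^k = P(x₀)`, `F(x₀, y₀) = 0`; `P`
monic of degree `M ≥ 1` with `M ≠ k` (`k ≥ 1`); `F` irreducible of positive `y₀`-degree,
`F(x₀, 0) ≢ 0`, rows of degree `≤ N`, top row `T ≠ 0` with a root `θ`; and, in case `θ ≠ 0`, either
`(k, M)` off the residue class or `θ` off the circle `M·log|θ| + Re p_{M−1} = 0`.  Then `S` has
Zariski-dense exponential points. [cite: MantovaMasser2023, §1 Further remarks, p. 5 (the question,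
open in general)] (new) -/
theorem unprojectedDense_superelliptic_fibreCurve_principal {S : Set (Fin 2 ⊕ Fin 2 → ℂ)}
    (hS : IsIrreducibleClosed ℂ S) (hdim : zariskiDim ℂ S ≤ (2 : ℕ)) {k : ℕ} (hk : 1 ≤ k)
    (hP : P.Monic) (hM : 1 ≤ P.natDegree) (hMk : P.natDegree ≠ k)
    (F : Polynomial (Polynomial ℂ)) (hFirr : Irreducible F) (hF1 : F.natDegree ≠ 0)
    (hF00 : F.coeff 0 ≠ 0) (N : ℕ) (hN : ∀ j, (F.coeff j).natDegree ≤ N)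
    (T : Polynomial ℂ) (hT : ∀ j, T.coeff j = (F.coeff j).coeff N) (hT0 : T ≠ 0) {θ : ℂ}
    (hTθ : T.IsRoot θ)
    (halt : θ = 0 ∨ ¬ (k ∣ 2 * P.natDegree ∧ (2 * P.natDegree / k) % 4 = 2) ∨
      (k < P.natDegree ∧
        (P.natDegree : ℝ) * Real.log ‖θ‖ + (P.coeff (P.natDegree - 1)).re ≠ 0))
    (hsub : ∀ x₀ x₁ y₀ : ℂ, x₁ ^ k - P.eval x₀ = 0 →
      (F.map (Polynomial.evalRingHom x₀)).eval y₀ = 0 →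
      (Sum.elim ![x₀, x₁] ![y₀, Complex.exp x₁] : Fin 2 ⊕ Fin 2 → ℂ) ∈ S) :
    UnprojectedDense S := by
  have hk0 : k ≠ 0 := by omega
  obtain ⟨e, ψ, he, hψan, hψ0, hbranch⟩ := exists_fibreCycle_puiseux F hFirr hF1 N hN T hT hT0 hTθ
  -- the fibre branch in the common parameter: `t = σ^k`, base parameter `s = σ^e`
  have hψk : AnalyticAt ℂ (fun σ : ℂ => ψ (σ ^ k)) 0 :=
    hψan.comp_of_eq (analyticAt_id.pow k) (by simp [zero_pow hk0])
  have hbranchk : ∀ᶠ σ in 𝓝[≠] (0 : ℂ),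
      (F.map (Polynomial.evalRingHom (σ ^ (e * k))⁻¹)).eval (ψ (σ ^ k)) = 0 := by
    filter_upwards [(tendsto_pow_punctured_nhds_zero hk).eventually hbranch] with σ hσ
    rw [mul_comm, pow_mul]
    exact hσ
  have germ_of_sheet : ∀ {Φ : ℂ → ℂ} {χ : ℂ → ℂ},
      (∀ᶠ s in 𝓝[≠] (0 : ℂ), (Φ s * (s ^ P.natDegree)⁻¹) ^ k - P.eval (s ^ k)⁻¹ = 0) →
      (∀ᶠ σ in 𝓝[≠] (0 : ℂ), χ σ = ψ (σ ^ k)) →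
      ∀ᶠ σ in 𝓝[≠] (0 : ℂ), (Sum.elim ![(σ ^ (e * k))⁻¹, Φ (σ ^ e) * (σ ^ (e * P.natDegree))⁻¹]
        ![χ σ, Complex.exp (Φ (σ ^ e) * (σ ^ (e * P.natDegree))⁻¹)] : Fin 2 ⊕ Fin 2 → ℂ) ∈ S := by
    intro Φ χ hsheet hχ
    filter_upwards [(tendsto_pow_punctured_nhds_zero he).eventually hsheet, hbranchk, hχ]
      with σ hs hb hχσ
    have h := hsub ((σ ^ (e * k))⁻¹) (Φ (σ ^ e) * (σ ^ (e * P.natDegree))⁻¹) (χ σ)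
      (by rw [pow_mul, pow_mul]; exact hs) (by rw [hχσ]; exact hb)
    simpa using h
  by_cases hθ0 : θ = 0
  · -- zero fibre value: the pole route (no direction condition since `M ≠ k`)
    have hne := fibreCycle_not_eventually_zero F hF00 he hbranch
    obtain ⟨j, g, hgan, hg0, hψg⟩ := (hψan.exists_eventuallyEq_pow_smul_nonzero_iff).2 hne
    have hj : 1 ≤ j := by
      rcases Nat.eq_zero_or_pos j with rfl | hj
      · exfalso
        have h := hψg.self_of_nhds
        rw [pow_zero, one_smul, hψ0, hθ0] at h
        exact hg0 h.symm
      · exact hj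
    refine unprojectedDense_superelliptic_sheets_pole_ram P hS hdim hk hP hM (Or.inl hMk) ?_
    intro ζ Φ hζ hΦan hΦ0 _ hsheet
    have hgk : AnalyticAt ℂ (fun σ : ℂ => g (σ ^ k)) 0 :=
      hgan.comp_of_eq (analyticAt_id.pow k) (by simp [zero_pow hk0])
    refine ⟨e, fun σ => g (σ ^ k), ((k * j : ℕ) : ℤ), he, hgk, by simpa [zero_pow hk0] using hg0,
      by exact_mod_cast Nat.mul_ne_zero hk0 (by omega), ?_⟩
    refine germ_of_sheet hsheet ?_
    have hpow0 : Tendsto (fun σ : ℂ => σ ^ k) (𝓝[≠] (0 : ℂ)) (𝓝 0) :=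
      (tendsto_pow_punctured_nhds_zero hk).mono_right nhdsWithin_le_nhds
    filter_upwards [hpow0.eventually hψg] with σ hσ
    rw [hσ, sub_zero, smul_eq_mul, zpow_natCast, pow_mul, mul_comm]
  · -- finite nonzero value on the principal sheet
    obtain ⟨Φ, hΦan, hΦ0, hΦt, -, hsheet⟩ := superelliptic_sheet_facts_taylor P hk hP hM
    refine unprojectedDense_superelliptic_principal_finite_ram P hS hdim hk hM hΦan hΦ0 hΦt he hψk
      hθ0 (by simpa [zero_pow hk0] using hψ0) (halt.resolve_left hθ0)
      (germ_of_sheet hsheet (Eventually.of_forall fun σ => rfl))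

/-- **Every hyperelliptic curve of degree `≥ 3`**: `S ⊇` cylinder over `{x₁² = P(x₀)} ×_{x₀} {F = 0}`
(`P` monic, `deg P ≥ 3`; `F` as above with a top-row root `θ`; when `θ ≠ 0` and `deg P ≡ 2 (mod 4)`,
`θ` off the circle `deg P·log|θ| + Re p_{M−1} = 0`) ⟹ dense.
[cite: MantovaMasser2023, §1 Further remarks, p. 5 (the question, open in general)] (new) -/
theorem unprojectedDense_hyperelliptic_fibreCurve {S : Set (Fin 2 ⊕ Fin 2 → ℂ)}
    (hS : IsIrreducibleClosed ℂ S) (hdim : zariskiDim ℂ S ≤ (2 : ℕ))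
    (hP : P.Monic) (h3 : 3 ≤ P.natDegree)
    (F : Polynomial (Polynomial ℂ)) (hFirr : Irreducible F) (hF1 : F.natDegree ≠ 0)
    (hF00 : F.coeff 0 ≠ 0) (N : ℕ) (hN : ∀ j, (F.coeff j).natDegree ≤ N)
    (T : Polynomial ℂ) (hT : ∀ j, T.coeff j = (F.coeff j).coeff N) (hT0 : T ≠ 0) {θ : ℂ}
    (hTθ : T.IsRoot θ)
    (halt : θ = 0 ∨ P.natDegree % 4 ≠ 2 ∨
      (P.natDegree : ℝ) * Real.log ‖θ‖ + (P.coeff (P.natDegree - 1)).re ≠ 0)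
    (hsub : ∀ x₀ x₁ y₀ : ℂ, x₁ ^ 2 - P.eval x₀ = 0 →
      (F.map (Polynomial.evalRingHom x₀)).eval y₀ = 0 →
      (Sum.elim ![x₀, x₁] ![y₀, Complex.exp x₁] : Fin 2 ⊕ Fin 2 → ℂ) ∈ S) :
    UnprojectedDense S := by
  refine unprojectedDense_superelliptic_fibreCurve_principal P hS hdim (k := 2) one_le_two hP
    (by omega) (by omega) F hFirr hF1 hF00 N hN T hT hT0 hTθ ?_ hsub
  rcases halt with h | h | h
  · exact Or.inl h
  · refine Or.inr (Or.inl ?_)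
    rintro ⟨-, h4⟩
    rw [Nat.mul_div_cancel_left _ (by norm_num : 0 < 2)] at h4
    exact h h4
  · exact Or.inr (Or.inr ⟨by omega, h⟩)

end Superelliptic

end Summit.Schanuel.Schanuel.Theorems

end
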